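import Literature.Geometry.Riemannian.HConcentrationOfBarrier
import Literature.Geometry.Riemannian.BamlerDistanceDistortion
import HarnessLib

/-!
# The metric flow of a compact Ricci flow is `H_n`-concentrated (Bamler 2023, §3.7), given
# Bamler's distance-distortion estimate (2020a, Thm. 3.5)

R. Bamler, *Compactness theory of the space of super Ricci flows*, Invent. Math. 233 (2023), §3.7,
Theorem: the metric flow of an `n`-dimensional super Ricci flow on a compact manifold is
`H_n`-concentrated, `H_n = (n − 1)π²/2 + 4` — by 2020a, Cor. 3.7, which rests on Thm. 3.5. With
Thm. 3.5 as the named fact `bamler_distSq_heatOperator_barrier` (`BamlerDistanceDistortion.lean`)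
and the proved chain barrier minimum principle ⇒ Cor. 3.6 for kernels ⇒ Cor. 3.7
(`HConcentrationOfBarrier.lean`), we record:

* `isHConcentrated_ricciFlowMetricFlow` — `(ricciFlowMetricFlow hh hR hS hflow).IsHConcentrated H_m`;
* `IsRicciFlow.isHConcentrated_metricFlow` — the same for `IsRicciFlow.metricFlow` (a flow given
  on `M × [0, T]` only).

CONDITIONAL on `bamler_distSq_heatOperator_barrier`; everything else is proved; no definitions.

## References

* R. H. Bamler, *Compactness theory of the space of super Ricci flows*, Invent. Math. 233 (2023),
  §3.4, §3.7. [Bamler2023]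
* R. H. Bamler, *Entropy and heat kernel bounds on a Ricci flow background*, arXiv:2008.07093
  (2020), §3, Thm. 3.5, Cor. 3.7. [Bamler2020Entropy]
-/

noncomputable section

open Bundle Set Function Filter Manifold MeasureTheory Measure TopologicalSpace
open scoped Manifold ContDiff Topology ENNReal NNReal

namespace Literature.Geometry.Riemannian

open Lorentzian Lorentzian.PseudoRiemannianMetric

universe u v

section Concentration

variable {m : ℕ} {H : Type v} [TopologicalSpace H]
  {I : ModelWithCorners ℝ (EuclideanSpace ℝ (Fin m)) H} [I.Boundaryless]
  {M : Type u} [TopologicalSpace M] [ChartedSpace H M] [IsManifold I ∞ M]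
  [T2Space M] [CompactSpace M] [SecondCountableTopology M] [MeasurableSpace M] [BorelSpace M]
  [ConnectedSpace M]
  {h : ℝ → PseudoRiemannianMetric I ∞ (EuclideanSpace ℝ (Fin m)) (TangentSpace I : M → Type _)}
  {cov : ℝ → CovariantDerivative I (EuclideanSpace ℝ (Fin m)) (TangentSpace I : M → Type _)}

/-- **The metric flow of a compact Ricci flow is `H_m`-concentrated** (Bamler 2023, §3.7), given
Bamler 2020a Thm. 3.5 in the barrier sense. [cite: Bamler2023, §3.7] -/
theorem isHConcentrated_ricciFlowMetricFlow (hV : bamler_distSq_heatOperator_barrier.{v, u})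
    (hm : 0 < m) (hh : IsContMDiffFamilyOn ∞ h univ) (hR : ∀ r, (h r).IsRiemannian) {S : Set ℝ}
    (hS : S.OrdConnected) (hflow : IsRicciFlow h cov S) :
    (ricciFlowMetricFlow hh hR hS hflow).IsHConcentrated (MetricFlow.concentrationConst m) := by
  have hb := hV (I := I) (M := M) h hR (cov := cov) (S := S) hS hm hh hflow
  exact isHConcentrated_ricciFlowMetricFlow_of_barrier hh hR hS hflow hb

/-- **The metric flow over `[0, T]` of a Ricci flow given on `M × [0, T]` is `H_m`-concentrated**
(Bamler 2023, §3.7), given Bamler 2020a Thm. 3.5 in the barrier sense. [cite: Bamler2023, §3.7] -/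
theorem IsRicciFlow.isHConcentrated_metricFlow (hV : bamler_distSq_heatOperator_barrier.{v, u})
    (hm : 0 < m)
    {g : ℝ → PseudoRiemannianMetric I ∞ (EuclideanSpace ℝ (Fin m)) (TangentSpace I : M → Type _)}
    {T : ℝ} (hT : 0 < T) (hflow : IsRicciFlow g cov (Icc 0 T)) (hR : ∀ s ∈ Icc 0 T, (g s).IsRiemannian) :
    (hflow.metricFlow hT hR).IsHConcentrated (MetricFlow.concentrationConst m) := by
  unfold IsRicciFlow.metricFlow
  exact isHConcentrated_ricciFlowMetricFlow hV hm _ _ ordConnected_Icc _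

end Concentration

end Literature.Geometry.Riemannian

end
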